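import Summits.AtomisticToContinuum.Crystallization.Theorems.ChartedZeroExcessLayeredLatticeLiouvilleZZZYRE

/-!
# ZZZYREC — the windowed hollow door WITHOUT the scale-band hypothesis (binder 26636, line (D); lens-2 g101, cure (G1) of memo W-g101)

Critic r1907 (D): the all-charts scale band `ScaleBandP s Λ c₀ ℓ₀ amin amax` (ZZZYRCZT) used by the doors `uniformEquilStabilityAt[In]_of_atlasW_hollow`
(ZZZYRCZX / ZZZYRE) is FALSE modulo an inhabitant for the atlas literals `[0.8602, 1.0442]` (anisotropic clean charts and the conformal gauge slack put
legal chart scales in `[0.8346, 0.8602) ∪ (1.0442, 1.0756]`, finding (W0)).  But the WINDOWED target `UniformEquilStabilityAtIn s Λ κ₀ c₀ W` only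
ever asks about scales `a ∈ W`: the band is not a fact to prove, it is the window itself.  This file folds the window into the class handed to the
class door `uniformEquilStabilityAtIn_of_atlasC` (ZZZYRE):

* `uniformReindexPCIn_window` — windowed re-indexing into `Can` is re-indexing into `Can ∧ (a ∈ W)`;
* `atlasCoversPC_of_shapeCoverWH_window` — a scale cover of `[amin, amax]` by H-band hollow cells covers the banded hollow class restricted to
  `a ∈ W ⊆ [amin, amax]` (JSBOX-SOUND without `ScaleBandP`);
* ★ `uniformEquilStabilityAtIn_of_atlasW_hollow_window` — the door of record for line (D) with `hband` REPLACED by `hW : W ⊆ Set.Icc amin amax`;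
  every other hypothesis verbatim.

No new definitions; proofs are re-assemblies of ZZZYRE / ZZZYRCZX lemmas.
-/

noncomputable section

namespace Summit.AtomisticToContinuum.Crystallization.Theorems.ChartedZeroExcessLayeredLatticeLiouville

open scoped BigOperators RealInnerProductSpace
open Summit.AtomisticToContinuum.Crystallization.Theorems.ChartedPlanarOrderRigidityDoor (E3)

variable {ι : Type*}

/-- windowed re-indexing into a class remembers the window: it is re-indexing into `Can ∧ (a ∈ W)`. [g101] -/
theorem uniformReindexPCIn_window {s Λ c₀ ℓ₀ : ℝ} {Can : ℝ → (E3 ≃L[ℝ] E3) → (ℤ → E3) → Prop} {W : Set ℝ}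
    (h : UniformReindexPCIn s Λ c₀ ℓ₀ Can W) : UniformReindexPCIn s Λ c₀ ℓ₀ (fun a L w' => Can a L w' ∧ a ∈ W) W := by
  intro a haW ha L w hE
  obtain ⟨w', hset, hco, hlip, hcan⟩ := h a haW ha L w hE
  exact ⟨w', hset, hco, hlip, hcan, haW⟩

/-- JSBOX-SOUND on a window: a scale cover of `[amin, amax]` by H-band hollow cells covers the banded hollow class RESTRICTED to scales
`a ∈ W ⊆ [amin, amax]` by hollow shape cells — the `ScaleBandP`-free twin of ZZZYRCZX's `atlasCoversPC_of_shapeCoverWH`. [g101] -/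
theorem atlasCoversPC_of_shapeCoverWH_window {s Λ c₀ ℓ₀ δ hLoB hHiB amin amax : ℝ} {W : Set ℝ} {aLo aHi τ hLo hHi : ι → ℝ}
    (hW : W ⊆ Set.Icc amin amax)
    (hcover : ∀ a : ℝ, amin ≤ a → a ≤ amax → ∃ i, aLo i ≤ a ∧ a ≤ aHi i ∧ δ ≤ τ i ∧ hLo i ≤ hLoB ∧ hHiB ≤ hHi i) :
    AtlasCoversPC s Λ c₀ ℓ₀ (fun a L w' => IsRegisteredWordBH δ hLoB hHiB a L w' ∧ a ∈ W)
      fun i => InBoxWH s (aLo i) (aHi i) (τ i) (hLo i) (hHi i) := by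
  intro a ha L w' hA hreg
  obtain ⟨i, haLo, haHi, hτ, hlo, hhi⟩ := hcover a (hW hreg.2).1 (hW hreg.2).2
  exact ⟨i, inBoxWH_of_registeredBH ha.le hA hreg.1 haLo haHi hτ hlo hhi⟩

/-- ★★ **THE WINDOWED R3-W DOOR WITHOUT THE SCALE BAND** (door of record for line (D) after finding (W0)): ZZZYRE's
`uniformEquilStabilityAtIn_of_atlasW_hollow` with `hband : ScaleBandP s Λ c₀ ℓ₀ amin amax` REPLACED by `hW : W ⊆ Set.Icc amin amax` — the
cells must cover the window, nothing is claimed about charts outside it.  All other hypotheses verbatim. [g101] -/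
theorem uniformEquilStabilityAtIn_of_atlasW_hollow_window {s Λ c₀ ℓ₀ r₁ ϱ R cZ κ₁ κ₀ γT δ hLoB hHiB amin amax : ℝ} {W : Set ℝ}
    {aLo aHi τ hLo hHi c cK : ι → ℝ} {ΘR ΘN : ι → (E3 ≃L[ℝ] E3) → (ℤ → E3) → (Cell 2 × ℤ) × (Cell 2 × ℤ) → ℝ}
    (h0 : 0 ≤ κ₁) (hκ : κ₀ ≤ κ₁ * cZ - γT) (hRI : UniformReindexPCIn s Λ c₀ ℓ₀ (IsRegisteredWord δ) W)
    (hHB : HBandP s Λ c₀ ℓ₀ hLoB hHiB) (hHol : HollowP s Λ c₀ ℓ₀ δ) (hcK0 : ∀ i, 0 ≤ cK i) (hcK : ∀ i, cK i * c i ≤ 1)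
    (hCS : CellSumP s Λ c₀ ℓ₀ r₁) (hNC : CellNullLagrangianP s Λ c₀ ℓ₀ r₁) (hW : W ⊆ Set.Icc amin amax)
    (hcover : ∀ a : ℝ, amin ≤ a → a ≤ amax → ∃ i, aLo i ≤ a ∧ a ≤ aHi i ∧ δ ≤ τ i ∧ hLo i ≤ hLoB ∧ hHiB ≤ hHi i)
    (hcell : ∀ i, BoxCellCertificateP s Λ c₀ ℓ₀ r₁ (InBoxWH s (aLo i) (aHi i) (τ i) (hLo i) (hHi i)) (c i))
    (htail : ∀ i, BoxTailDebitP s Λ c₀ ℓ₀ ϱ (InBoxWH s (aLo i) (aHi i) (τ i) (hLo i) (hHi i)) (ΘR i) (ΘN i) γT)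
    (hPU : PartitionIdentityFullP s Λ c₀ ℓ₀ r₁ ϱ R) (hPD : PartitionIdentityDebitP s Λ c₀ ℓ₀ ϱ R)
    (hclus : ∀ i, BoxClusterCertificateDebitP s Λ c₀ ℓ₀ r₁ ϱ R (InBoxWH s (aLo i) (aHi i) (τ i) (hLo i) (hHi i)) (cK i) (ΘR i) (ΘN i) κ₁)
    (hCZ : IndexCurrencyP s Λ c₀ ℓ₀ r₁ cZ) : UniformEquilStabilityAtIn s Λ κ₀ c₀ W :=
  uniformEquilStabilityAtIn_of_atlasC h0 hκ (uniformReindexPCIn_window (uniformReindexPCIn_bandedHollow hRI hHB hHol)) hcK0 hcK hCS hNC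
    (atlasCoversPC_of_shapeCoverWH_window hW hcover) hcell htail hPU hPD hclus hCZ

/-- the instance of record: the window IS the covered interval, `W = Set.Icc amin amax`. [g101] -/
theorem uniformEquilStabilityAtIn_of_atlasW_hollow_Icc {s Λ c₀ ℓ₀ r₁ ϱ R cZ κ₁ κ₀ γT δ hLoB hHiB amin amax : ℝ}
    {aLo aHi τ hLo hHi c cK : ι → ℝ} {ΘR ΘN : ι → (E3 ≃L[ℝ] E3) → (ℤ → E3) → (Cell 2 × ℤ) × (Cell 2 × ℤ) → ℝ}
    (h0 : 0 ≤ κ₁) (hκ : κ₀ ≤ κ₁ * cZ - γT) (hRI : UniformReindexPCIn s Λ c₀ ℓ₀ (IsRegisteredWord δ) (Set.Icc amin amax))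
    (hHB : HBandP s Λ c₀ ℓ₀ hLoB hHiB) (hHol : HollowP s Λ c₀ ℓ₀ δ) (hcK0 : ∀ i, 0 ≤ cK i) (hcK : ∀ i, cK i * c i ≤ 1)
    (hCS : CellSumP s Λ c₀ ℓ₀ r₁) (hNC : CellNullLagrangianP s Λ c₀ ℓ₀ r₁)
    (hcover : ∀ a : ℝ, amin ≤ a → a ≤ amax → ∃ i, aLo i ≤ a ∧ a ≤ aHi i ∧ δ ≤ τ i ∧ hLo i ≤ hLoB ∧ hHiB ≤ hHi i)
    (hcell : ∀ i, BoxCellCertificateP s Λ c₀ ℓ₀ r₁ (InBoxWH s (aLo i) (aHi i) (τ i) (hLo i) (hHi i)) (c i))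
    (htail : ∀ i, BoxTailDebitP s Λ c₀ ℓ₀ ϱ (InBoxWH s (aLo i) (aHi i) (τ i) (hLo i) (hHi i)) (ΘR i) (ΘN i) γT)
    (hPU : PartitionIdentityFullP s Λ c₀ ℓ₀ r₁ ϱ R) (hPD : PartitionIdentityDebitP s Λ c₀ ℓ₀ ϱ R)
    (hclus : ∀ i, BoxClusterCertificateDebitP s Λ c₀ ℓ₀ r₁ ϱ R (InBoxWH s (aLo i) (aHi i) (τ i) (hLo i) (hHi i)) (cK i) (ΘR i) (ΘN i) κ₁)
    (hCZ : IndexCurrencyP s Λ c₀ ℓ₀ r₁ cZ) : UniformEquilStabilityAtIn s Λ κ₀ c₀ (Set.Icc amin amax) :=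
  uniformEquilStabilityAtIn_of_atlasW_hollow_window h0 hκ hRI hHB hHol hcK0 hcK hCS hNC subset_rfl hcover hcell htail hPU hPD hclus hCZ

end Summit.AtomisticToContinuum.Crystallization.Theorems.ChartedZeroExcessLayeredLatticeLiouville

end
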